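import Summits.BirchSwinnertonDyer.Rank1Residual.Additive.X3BranchLayerOneField
import Summits.BirchSwinnertonDyer.Rank1Residual.Additive.X3BranchKummerLayerCubeAtThree
import Summits.BirchSwinnertonDyer.Rank1Residual.X2.GreenbergVatsalUnramifiedAway
import HarnessLib

/-!
# X3, the DEGENERATE rows OFF the sub-locus: the Kummer class of a `Σ₀`-unit of the first layer
# `ℚ_1 = ℚ(θ)` lies in Greenberg–Vatsal's `U` (cell `bsd-eis`, seat `bsd-eis-x3` gen 7; assembles
# `X3BranchKummerLayerClasses/Local/CubeAtThree.lean` and `X3BranchLayerOneField.lean`; route K1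
# `AdditiveBranchIMC`, crux `GordTwoRankZeroOffCaseOne` — supports only)

HONEST FRAMING (cell `bsd-eis`, `run/shared/lean/pub/bsd-eis/README.md` §4): the programme's target of
record is the full Birch–Swinnerton-Dyer formula for every `E/ℚ` of analytic rank `≤ 1`; this file is a
step of the U-side LOWER BOUND of the degenerate certificate road on the rows with a prime
`ℓ ≡ ±1 (mod 9)` in `Σ₀` (x3-MEMO-9 §2.4 (e)). THEOREMS ONLY (no `def`, no named fact, no `sorry`);
nothing is booked; no label, tier or count of record moves.

## What (`θ = ζ₉ + ζ₉⁻¹`, `θ³ = 3θ − 1`; a unit `a = P(θ)`, `P = (P₀, P₁, P₂) ∈ ℤ³`)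

* §1 `smul_theta_mem_roots` — `τθ ∈ {θ, θ² − 2, −θ² − θ + 2}` for every `τ ∈ Γ_ℚ` (the three roots of
  `X³ − 3X + 1`); `smul_eval_theta` — `τ·P(θ) = P(τθ)`.
* §2 `exists_goodRoot` — from a certificate `P(θ)·D(θ)³ = 1 + 9T(θ)` (`D, T ∈ ℤ³`): a cube root `β` of
  `P(θ)` fixed by every `σ ∈ D_{v₃}` with `σθ = θ` (`exists_cubeRoot_smul_eq_self_of_decomp` divided by
  `D(θ) ≠ 0`; `1, θ, θ²` are `ℚ`-independent).
* §3 `kummerClass_mem_unramifiedSelmer` — for `a = P(θ)` with conjugates `P'(θ), P''(θ)`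
  (`P(θ²−2) = P'(θ)`, `P(−θ²−θ+2) = P''(θ)`), norm `P·P'·P'' (θ) = n ∈ ℕ` supported on `Σ₀`, and cube
  certificates for `P, P', P''`: the class on `G_{ℚ_∞} = ker κ` of the Kummer cocycle of `a` (w.r.t.
  ANY cube root) lies in `unramifiedSelmer` — unramified away from `Σ₀ ∪ {3}` by
  `smul_eq_self_of_mem_inertia_of_pow_eq_of_dvd` (the inertia groups lie in `ker κ`, which fixes
  `ℚ_1`), at `3` by §2, for every conjugate by `conjH1_eq_of_kummer` + `class_eq_of_root_mul_pow`.

References: [GreenbergVatsal2000] §2 pp. 28–30; [SerreLocalFields1979] Ch. X §3; [Washington1997]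
§13.1; cell file `run/shared/lean/pub/bsd-eis/x3-MEMO-9.md` §2.
-/

set_option autoImplicit false

noncomputable section

open scoped Classical NumberField

namespace Summit.BirchSwinnertonDyer.Rank1Residual.Additive

namespace KummerLayerClasses

open NumberField IsDedekindDomain Field
  Literature.NumberTheory.GaloisRepresentations
  Literature.NumberTheory.EllipticCurves
  Literature.NumberTheory.EllipticCurves.GreenbergSelmer
  Literature.NumberTheory.EllipticCurves.GreenbergVatsal2000
  Literature.NumberTheory.NumberFields
  Summit.BirchSwinnertonDyer.Rank1Residual.Iwasawa.CyclotomicLayerOne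
  KummerLineClasses

/-! ### §1 Conjugates of `θ` and of `P(θ)` -/

/-- **`τθ` is one of the three roots `θ, θ² − 2, −θ² − θ + 2` of `X³ − 3X + 1`** (`θ³ = 3θ − 1`):
`X³ − 3X + 1 = (X − θ)(X − (θ² − 2))(X − (−θ² − θ + 2))`. [cite: Washington1997, §13.1] -/
theorem smul_theta_mem_roots {θ : AlgebraicClosure ℚ} (hθ : θ ^ 3 = 3 * θ - 1)
    (τ : absoluteGaloisGroup ℚ) :
    τ • θ = θ ∨ τ • θ = θ ^ 2 - 2 ∨ τ • θ = -θ ^ 2 - θ + 2 := by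
  have h1 : (τ • θ) ^ 3 = 3 * (τ • θ) - 1 := by
    have := congrArg (absoluteGaloisGroup.toAlgEquiv ℚ τ) hθ
    rw [absoluteGaloisGroup.smul_def]
    simpa [map_pow, map_sub, map_mul, map_ofNat] using this
  set g := τ • θ with hg
  have hfac : (g - θ) * (g - (θ ^ 2 - 2)) * (g - (-θ ^ 2 - θ + 2)) = 0 := by
    linear_combination h1 + (θ ^ 2 - g * θ + θ - g - 1) * hθ
  rcases mul_eq_zero.mp hfac with h | h
  · rcases mul_eq_zero.mp h with h | h
    · exact Or.inl (sub_eq_zero.mp h)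
    · exact Or.inr (Or.inl (sub_eq_zero.mp h))
  · exact Or.inr (Or.inr (sub_eq_zero.mp h))

/-- `τ·(c₀ + c₁θ + c₂θ²) = c₀ + c₁(τθ) + c₂(τθ)²` for `c ∈ ℤ³`. [folklore] -/
theorem smul_eval_theta (θ : AlgebraicClosure ℚ) (c₀ c₁ c₂ : ℤ) (τ : absoluteGaloisGroup ℚ) :
    τ • ((c₀ : AlgebraicClosure ℚ) + c₁ * θ + c₂ * θ ^ 2) =
      (c₀ : AlgebraicClosure ℚ) + c₁ * (τ • θ) + c₂ * (τ • θ) ^ 2 := by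
  rw [absoluteGaloisGroup.smul_def, absoluteGaloisGroup.smul_def]
  simp [map_add, map_mul, map_pow, map_intCast]

/-- `1, θ, θ²` are `ℚ`-independent: `c₀ + c₁θ + c₂θ² = 0` with `c ∈ ℤ³` forces `c = 0`
(`X³ − 3X + 1` is the minimal polynomial and divides no non-zero polynomial of degree `≤ 2`).
[folklore] -/
theorem eq_zero_of_eval_theta_eq_zero {θ : AlgebraicClosure ℚ} (hθ : θ ^ 3 = 3 * θ - 1)
    {c₀ c₁ c₂ : ℤ} (h : (c₀ : AlgebraicClosure ℚ) + c₁ * θ + c₂ * θ ^ 2 = 0) :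
    c₀ = 0 ∧ c₁ = 0 ∧ c₂ = 0 := by
  open Polynomial in
  set q : ℤ[X] := C c₂ * X ^ 2 + C c₁ * X + C c₀ with hq
  have hP : aeval θ q = 0 := by
    simp only [hq, map_add, map_mul, map_pow, aeval_X, aeval_C]
    simp only [eq_intCast]
    linear_combination h
  have hdvd := poly_dvd_of_aeval_eq_zero hθ hP
  have hq0 : q = 0 := Polynomial.eq_zero_of_dvd_of_natDegree_lt hdvd
    (lt_of_le_of_lt Polynomial.natDegree_quadratic_le (by rw [MonicCubic.natDegree_poly]; norm_num))
  have h0 := congrArg (fun p : ℤ[X] ↦ p.coeff 0) hq0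
  have h1 := congrArg (fun p : ℤ[X] ↦ p.coeff 1) hq0
  have h2 := congrArg (fun p : ℤ[X] ↦ p.coeff 2) hq0
  simp only [hq, coeff_add, coeff_C_mul_X_pow, coeff_C_mul_X, coeff_C, coeff_zero] at h0 h1 h2
  simp at h0 h1 h2
  exact ⟨h0, h1, h2⟩

/-- **Integrality**: `c₀ + c₁θ + c₂θ²` (`c ∈ ℤ³`, `θ³ = 3θ − 1`) is integral over `𝓞 ℚ`. [folklore] -/
theorem isIntegral_eval_theta {θ : AlgebraicClosure ℚ} (hθ : θ ^ 3 = 3 * θ - 1) (c₀ c₁ c₂ : ℤ) :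
    IsIntegral (𝓞 ℚ) ((c₀ : AlgebraicClosure ℚ) + c₁ * θ + c₂ * θ ^ 2) := by
  have hθ' : IsIntegral (𝓞 ℚ) θ := (MonicCubic.isIntegral_of_aeval (aeval_poly_eq_zero hθ)).tower_top
  have hc : ∀ c : ℤ, IsIntegral (𝓞 ℚ) (c : AlgebraicClosure ℚ) := fun c ↦ by
    have := isIntegral_algebraMap (R := 𝓞 ℚ) (A := AlgebraicClosure ℚ) (x := (c : 𝓞 ℚ))
    rwa [map_intCast] at this
  exact ((hc c₀).add ((hc c₁).mul hθ')).add ((hc c₂).mul (hθ'.pow 2))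

/-! ### §2 A cube root of `P(θ)` fixed by the decomposition group elements fixing `θ` -/

/-- **The good cube root.** From the certificate `P(θ)·D(θ)³ = 1 + 9T(θ)` (`P, D, T ∈ ℤ³`,
`θ³ = 3θ − 1`): `D(θ) ≠ 0` (else `1 + 9T(θ) = 0`, impossible by independence of `1, θ, θ²`), and
`β = β'/D(θ)` — `β'` the cube root of `1 + 9T(θ)` of `exists_cubeRoot_smul_eq_self_of_decomp` — is a
cube root of `P(θ)` fixed by every `σ ∈ D_{v₃}` with `σθ = θ`.
[cite: Cassels1986, Ch. 4 Lemma 3.1] [cite: NeukirchANT1999, Ch. II (9.6)] -/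
theorem exists_goodRoot {θ : AlgebraicClosure ℚ} (hθ : θ ^ 3 = 3 * θ - 1) (P D T : Fin 3 → ℤ)
    (hcube : ((P 0 : AlgebraicClosure ℚ) + P 1 * θ + P 2 * θ ^ 2) *
      ((D 0 : AlgebraicClosure ℚ) + D 1 * θ + D 2 * θ ^ 2) ^ 3 =
      1 + 9 * ((T 0 : AlgebraicClosure ℚ) + T 1 * θ + T 2 * θ ^ 2)) :
    ∃ β : AlgebraicClosure ℚ, β ^ 3 = (P 0 : AlgebraicClosure ℚ) + P 1 * θ + P 2 * θ ^ 2 ∧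
      ∀ σ ∈ decomp ((Rat.HeightOneSpectrum.primesEquiv (R := 𝓞 ℚ)).symm ⟨3, Nat.prime_three⟩),
        σ • θ = θ → σ • β = β := by
  set d : AlgebraicClosure ℚ := (D 0 : AlgebraicClosure ℚ) + D 1 * θ + D 2 * θ ^ 2 with hd
  have hd0 : d ≠ 0 := by
    intro h0
    rw [h0, zero_pow three_ne_zero, mul_zero] at hcube
    have h' : ((1 + 9 * T 0 : ℤ) : AlgebraicClosure ℚ) + (9 * T 1 : ℤ) * θ + (9 * T 2 : ℤ) * θ ^ 2 = 0 := by
      push_cast; linear_combination -hcube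
    have := (eq_zero_of_eval_theta_eq_zero hθ h').1
    omega
  obtain ⟨β', hβ', hfix⟩ := exists_cubeRoot_smul_eq_self_of_decomp hθ (T 0) (T 1) (T 2)
  refine ⟨β' / d, ?_, fun σ hσ hσθ ↦ ?_⟩
  · rw [div_pow, hβ', ← hcube, mul_div_assoc, div_self (pow_ne_zero _ hd0), mul_one]
  · have hσd : σ • d = d := by rw [hd, smul_eval_theta, hσθ]
    have hσβ' := hfix σ hσ hσθ
    rw [absoluteGaloisGroup.smul_def] at hσd hσβ' ⊢
    rw [map_div₀, hσβ', hσd]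

/-! ### §3′ Membership in `U` from vanishing on `I_v ∩ H` only -/

section Classes

variable {Ψ : Type} [AddCommGroup Ψ] [DistribMulAction (absoluteGaloisGroup ℚ) Ψ]
  [TopologicalSpace Ψ] [DiscreteTopology Ψ] (H : Subgroup (absoluteGaloisGroup ℚ)) [H.Normal]

omit [H.Normal] in
/-- **A cocycle vanishing on `I_v ∩ H` gives a class unramified at `v`** (as gen 6's
`mem_unramifiedKer_of_cocycle`, asking the vanishing only on `H`). [folklore] -/
theorem mem_unramifiedKer_of_cocycle_of_mem (f : absoluteGaloisGroup ℚ → Ψ)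
    (F : contOneCocycles (discreteTopRep H Ψ)) (hF : ∀ h : H, F.1 h = f h)
    (v : HeightOneSpectrum (𝓞 ℚ)) (hv : ∀ τ ∈ inertia v, τ ∈ H → f τ = 0) :
    oneCocycleClass (discreteTopRep H Ψ) F ∈ GreenbergVatsal2000.unramifiedKer H Ψ v := by
  rw [GreenbergVatsal2000.unramifiedKer, ← resKer_eq_ker, oneCocycleClass_mem_resKer_iff]
  refine ⟨0, fun x ↦ ?_⟩
  rw [smul_zero, sub_zero, AddMonoidHom.id_apply, hF]
  exact hv _ ((mem_inertiaIn_iff H v x.1).1 x.2).2 ((mem_inertiaIn_iff H v x.1).1 x.2).1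

/-- **A class in GV's `U` from conjugate representatives vanishing on `I_v ∩ H`** (as
`mem_unramifiedSelmer_of_conj` of `X3BranchKummerLayerClasses.lean`, asking the vanishing only on
`H`). [cite: GreenbergVatsal2000, §2 pp. 28–29] -/
theorem mem_unramifiedSelmer_of_conj_of_mem (p : ℕ) (F : contOneCocycles (discreteTopRep H Ψ))
    (S₀ : Set (HeightOneSpectrum (𝓞 ℚ)))
    (hconj : ∀ τ : absoluteGaloisGroup ℚ, ∃ (f' : absoluteGaloisGroup ℚ → Ψ)
      (F' : contOneCocycles (discreteTopRep H Ψ)), (∀ h : H, F'.1 h = f' h) ∧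
      conjH1 H Ψ τ (oneCocycleClass (discreteTopRep H Ψ) F) = oneCocycleClass (discreteTopRep H Ψ) F' ∧
      (∀ v : HeightOneSpectrum (𝓞 ℚ), v ∉ S₀ → ∀ σ ∈ inertia v, σ ∈ H → f' σ = 0) ∧
      (∀ v : HeightOneSpectrum (𝓞 ℚ), ((p : ℕ) : 𝓞 ℚ) ∈ v.asIdeal → ∀ σ ∈ inertia v, σ ∈ H → f' σ = 0)) :
    oneCocycleClass (discreteTopRep H Ψ) F ∈ unramifiedSelmer H Ψ p S₀ := by
  refine AddSubgroup.mem_inf.mpr ⟨?_, ?_⟩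
  · rw [mem_unramifiedOutside_iff]
    intro v hvS _ τ
    obtain ⟨f', F', hF', hc, hv, -⟩ := hconj τ
    rw [hc]
    exact mem_unramifiedKer_of_cocycle_of_mem H f' F' hF' v (hv v hvS)
  · simp only [AddSubgroup.mem_iInf, AddSubgroup.mem_comap]
    intro v hvp τ
    obtain ⟨f', F', hF', hc, -, hv⟩ := hconj τ
    rw [hc]
    exact mem_unramifiedKer_of_cocycle_of_mem H f' F' hF' v (hv v hvp)

end Classes

/-! ### §3 The Kummer class of a layer unit lies in GV's `U` -/

/-- **The class of a `Σ₀`-unit of `ℚ_1` lies in `U`.** `κ` cyclotomic, `H = ker κ`, `Ψ` an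
`ω`-line with `3·y₀ = 0`, `ζ₃` a primitive cube root of unity, `θ = ζ + ζ⁸` (`ζ` of order `9`);
`a = P(θ)` with conjugates `P(θ² − 2) = P'(θ)`, `P(−θ² − θ + 2) = P''(θ)`; norm
`P(θ)·(P'(θ)·P''(θ)) = n ∈ ℕ`, `n ≠ 0`, every prime of `n` under `Σ₀`; a cube certificate for each of
`P, P', P''`. Then for every cocycle `F` on `H` of Kummer type for a cube root `β` of `a`
(`F(h) = m_h y₀`, `hβ = ζ₃^{m_h}β`), `[F] ∈ unramifiedSelmer H Ψ 3 Σ₀`. Proof: for `τ ∈ Γ_ℚ`,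
`τa ∈ {a, a', a''}` (`smul_theta_mem_roots`); `conj_τ[F]` is the class of the Kummer cocycle of `τa`
w.r.t. `τβ` (`conjH1_eq_of_kummer`), equally w.r.t. the GOOD root of §2 (`class_eq_of_root_mul_pow`);
that cocycle vanishes on `I_v ∩ H` for `v ∉ Σ₀`, `v ∤ 3` (`smul_eq_self_of_mem_inertia_of_pow_eq_of_dvd`:
`I_v ≤ ker κ` fixes `θ`; `τa·(the other two conjugates) = n ∉ v`) and for `v ∣ 3` (the good root is
fixed by `{σ ∈ D_v | σθ = θ} ⊇ I_v ∩ ker κ`). [cite: GreenbergVatsal2000, §2 pp. 28–29]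
[cite: SerreLocalFields1979, Ch. X §3] -/
theorem kummerClass_mem_unramifiedSelmer [hp : Fact (Nat.Prime 3)] (κ : ZpExtension ℚ 3)
    (hκ : κ.IsCyclotomic) (S₀ : Finset (HeightOneSpectrum (𝓞 ℚ)))
    {Ψ : Type} [AddCommGroup Ψ] [DistribMulAction (absoluteGaloisGroup ℚ) Ψ]
    [TopologicalSpace Ψ] [DiscreteTopology Ψ]
    (hΨ : ∀ (σ : absoluteGaloisGroup ℚ) (y : Ψ),
      σ • y = ((modNCyclotomicCharacter ℚ 3 σ : (ZMod 3)ˣ) : ZMod 3).val • y)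
    {y₀ : Ψ} (hy₀ : 3 • y₀ = 0) {ζ₃ : AlgebraicClosure ℚ} (hζ₃ : IsPrimitiveRoot ζ₃ 3)
    {ζ θ : AlgebraicClosure ℚ} (hζ : IsPrimitiveRoot ζ 9) (hθζ : θ = ζ + ζ ^ 8)
    (P P' P'' : Fin 3 → ℤ)
    (hP' : (P 0 : AlgebraicClosure ℚ) + P 1 * (θ ^ 2 - 2) + P 2 * (θ ^ 2 - 2) ^ 2 =
      (P' 0 : AlgebraicClosure ℚ) + P' 1 * θ + P' 2 * θ ^ 2)
    (hP'' : (P 0 : AlgebraicClosure ℚ) + P 1 * (-θ ^ 2 - θ + 2) + P 2 * (-θ ^ 2 - θ + 2) ^ 2 =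
      (P'' 0 : AlgebraicClosure ℚ) + P'' 1 * θ + P'' 2 * θ ^ 2)
    (n : ℕ) (hn0 : n ≠ 0)
    (hnorm : ((P 0 : AlgebraicClosure ℚ) + P 1 * θ + P 2 * θ ^ 2) *
      (((P' 0 : AlgebraicClosure ℚ) + P' 1 * θ + P' 2 * θ ^ 2) *
        ((P'' 0 : AlgebraicClosure ℚ) + P'' 1 * θ + P'' 2 * θ ^ 2)) = (n : AlgebraicClosure ℚ))
    (hnS : ∀ v : HeightOneSpectrum (𝓞 ℚ), ((n : ℕ) : 𝓞 ℚ) ∈ v.asIdeal → v ∈ S₀)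
    (hcube : ∀ Q ∈ ({P, P', P''} : Set (Fin 3 → ℤ)), ∃ D T : Fin 3 → ℤ,
      ((Q 0 : AlgebraicClosure ℚ) + Q 1 * θ + Q 2 * θ ^ 2) *
        ((D 0 : AlgebraicClosure ℚ) + D 1 * θ + D 2 * θ ^ 2) ^ 3 =
        1 + 9 * ((T 0 : AlgebraicClosure ℚ) + T 1 * θ + T 2 * θ ^ 2))
    {β : AlgebraicClosure ℚ} (hβ : β ^ 3 = (P 0 : AlgebraicClosure ℚ) + P 1 * θ + P 2 * θ ^ 2)
    (F : contOneCocycles (discreteTopRep κ.kerSubgroup Ψ))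
    (hF : ∀ h : κ.kerSubgroup, ∃ m : ℕ, (h : absoluteGaloisGroup ℚ) • β = ζ₃ ^ m * β ∧ F.1 h = m • y₀) :
    oneCocycleClass (discreteTopRep κ.kerSubgroup Ψ) F ∈
      unramifiedSelmer κ.kerSubgroup Ψ 3 (↑S₀ : Set (HeightOneSpectrum (𝓞 ℚ))) := by
  haveI : NeZero ((3 : ℕ) : ℚ) := ⟨by norm_num⟩
  have hθ : θ ^ 3 = 3 * θ - 1 := by rw [hθζ]; linear_combination theta_cubic hζ
  -- names for the three conjugates
  set a : AlgebraicClosure ℚ := (P 0 : AlgebraicClosure ℚ) + P 1 * θ + P 2 * θ ^ 2 with ha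
  set a' : AlgebraicClosure ℚ := (P' 0 : AlgebraicClosure ℚ) + P' 1 * θ + P' 2 * θ ^ 2 with ha'
  set a'' : AlgebraicClosure ℚ := (P'' 0 : AlgebraicClosure ℚ) + P'' 1 * θ + P'' 2 * θ ^ 2 with ha''
  have hβ0 : β ≠ 0 := by
    rintro rfl
    rw [zero_pow three_ne_zero] at hβ
    apply hn0
    have := hnorm; rw [← hβ, zero_mul] at this; exact_mod_cast this.symm
  -- the place `v₃` and its uniqueness
  set v₃ : HeightOneSpectrum (𝓞 ℚ) :=
    (Rat.HeightOneSpectrum.primesEquiv (R := 𝓞 ℚ)).symm ⟨3, Nat.prime_three⟩ with hv₃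
  have hv₃3 : ((3 : ℕ) : 𝓞 ℚ) ∈ v₃.asIdeal :=
    (Literature.NumberTheory.Automorphic.BCDT.natCast_mem_asIdeal_iff_primesEquiv_eq v₃ hp.out).mpr
      (by rw [hv₃, Equiv.apply_symm_apply])
  have huniq3 : ∀ v : HeightOneSpectrum (𝓞 ℚ), ((3 : ℕ) : 𝓞 ℚ) ∈ v.asIdeal → v = v₃ := fun v hv ↦ by
    have h1 := (Literature.NumberTheory.Automorphic.BCDT.natCast_mem_asIdeal_iff_primesEquiv_eq v hp.out).mp hv
    have h2 := (Literature.NumberTheory.Automorphic.BCDT.natCast_mem_asIdeal_iff_primesEquiv_eq v₃ hp.out).mp hv₃3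
    exact Rat.HeightOneSpectrum.primesEquiv.injective (Subtype.ext (h1.trans h2.symm))
  -- `ker κ` fixes `θ`; the inertia groups away from `3` lie in `ker κ`
  have hkerθ : ∀ σ ∈ κ.kerSubgroup, σ • θ = θ := by
    intro σ hσ
    have hmem := zeta_add_pow_mem_layer_one hκ ζ hζ.pow_eq_one
    rw [ZpExtension.layer, IntermediateField.mem_fixedField_iff] at hmem
    rw [hθζ]
    exact hmem _ (Subgroup.mem_map.mpr ⟨σ, κ.kerSubgroup_le_layerSubgroup 1 hσ, rfl⟩)
  have hIker : ∀ v : HeightOneSpectrum (𝓞 ℚ), ((3 : ℕ) : 𝓞 ℚ) ∉ v.asIdeal →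
      ∀ σ ∈ inertia v, σ ∈ κ.kerSubgroup := fun v hv σ hσ ↦
    X2.GreenbergVatsalUnramifiedAway.inertia_le_kerSubgroup_of_isCyclotomic κ v hκ hv hσ
  -- the conjugate `τa` with its data: a cube root fixed by `D_{v₃} ∩ {σθ = θ}` and a co-factor to `n`
  have hconj : ∀ τ : absoluteGaloisGroup ℚ, ∃ (Q : Fin 3 → ℤ) (b : AlgebraicClosure ℚ),
      τ • a = (Q 0 : AlgebraicClosure ℚ) + Q 1 * θ + Q 2 * θ ^ 2 ∧ Q ∈ ({P, P', P''} : Set (Fin 3 → ℤ)) ∧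
      IsIntegral (𝓞 ℚ) b ∧ ((Q 0 : AlgebraicClosure ℚ) + Q 1 * θ + Q 2 * θ ^ 2) * b = n := by
    intro τ
    rcases smul_theta_mem_roots hθ τ with hτ | hτ | hτ
    · refine ⟨P, a' * a'', ?_, by simp, (isIntegral_eval_theta hθ _ _ _).mul (isIntegral_eval_theta hθ _ _ _), hnorm⟩
      rw [ha, smul_eval_theta, hτ]
    · refine ⟨P', a * a'', ?_, by simp, (isIntegral_eval_theta hθ _ _ _).mul (isIntegral_eval_theta hθ _ _ _), ?_⟩
      · rw [ha, smul_eval_theta, hτ, hP']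
      · rw [← hnorm]; ring
    · refine ⟨P'', a * a', ?_, by simp, (isIntegral_eval_theta hθ _ _ _).mul (isIntegral_eval_theta hθ _ _ _), ?_⟩
      · rw [ha, smul_eval_theta, hτ, hP'']
      · rw [← hnorm]; ring
  -- membership through conjugate representatives
  refine mem_unramifiedSelmer_of_conj_of_mem κ.kerSubgroup 3 F (↑S₀) fun τ ↦ ?_
  obtain ⟨Q, b, hτa, hQ, hbint, hQb⟩ := hconj τ
  obtain ⟨D, T, hDT⟩ := hcube Q hQ
  obtain ⟨βτ, hβτ, hβτfix⟩ := exists_goodRoot hθ Q D T hDT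
  -- `βτ` is a cube root of `τ a = (τ β)³`: `βτ = ζ₃^j · τβ`
  have hτβ3 : (τ • β) ^ 3 = τ • a := by rw [← smul_pow', hβ]
  have hτa0 : τ • a ≠ 0 := by
    rw [hτa]; intro h0; apply hn0
    have := hQb; rw [h0, zero_mul] at this; exact_mod_cast this.symm
  have hτβ0 : τ • β ≠ 0 := by
    intro h0; rw [h0, zero_pow three_ne_zero] at hτβ3; exact hτa0 hτβ3.symm
  obtain ⟨j, -, hj⟩ : ∃ j : ℕ, j < 3 ∧ βτ = ζ₃ ^ j * (τ • β) := by
    have hq : (βτ / (τ • β)) ^ 3 = 1 := by rw [div_pow, hβτ, ← hτa, ← hτβ3, div_self (pow_ne_zero _ hτβ0)]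
    obtain ⟨j, hj, hζj⟩ := hζ₃.eq_pow_of_pow_eq_one hq
    exact ⟨j, hj, by rw [hζj, div_mul_cancel₀ _ hτβ0]⟩
  -- the Kummer cocycles of `τ a` on `ker κ` (which fixes `τ a`): w.r.t. the good root `βτ` and w.r.t. `τβ`
  have hkera : ∀ σ ∈ κ.kerSubgroup, σ • (τ • a) = τ • a := fun σ hσ ↦ by
    rw [hτa, smul_eval_theta, hkerθ σ hσ]
  have hβτ' : βτ ^ 3 = τ • a := by rw [hτa]; exact hβτ
  obtain ⟨fτ, hfτc, hfτcoc, hfτrel⟩ := exists_kummerCocycle (p := 3) κ.kerSubgroup hΨ y₀ hy₀ hζ₃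
    hτa0 hkera hβτ'
  obtain ⟨Fτ, cτ, hFτ, hcτ⟩ := exists_class_of_cocycle κ.kerSubgroup le_rfl fτ hfτc hfτcoc
  obtain ⟨f₁, hf₁c, hf₁coc, hf₁rel⟩ := exists_kummerCocycle (p := 3) κ.kerSubgroup hΨ y₀ hy₀ hζ₃
    hτa0 hkera hτβ3
  obtain ⟨F₁, c₁, hF₁, hc₁⟩ := exists_class_of_cocycle κ.kerSubgroup le_rfl f₁ hf₁c hf₁coc
  -- `fτ` vanishes at every `σ ∈ ker κ` fixing the good root
  have hβτ0 : βτ ≠ 0 := by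
    rw [hj]; exact mul_ne_zero (pow_ne_zero _ (hζ₃.ne_zero three_ne_zero)) hτβ0
  have hvanish : ∀ σ ∈ κ.kerSubgroup, σ • βτ = βτ → fτ σ = 0 := by
    intro σ hσ hfix
    obtain ⟨m, hm, hfm⟩ := hfτrel σ hσ
    rw [hfix] at hm
    have hζm : ζ₃ ^ m = 1 := by
      have h1 : ζ₃ ^ m * βτ = 1 * βτ := by rw [one_mul]; exact hm.symm
      exact mul_right_cancel₀ hβτ0 h1
    obtain ⟨k, rfl⟩ := (hζ₃.pow_eq_one_iff_dvd m).mp hζm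
    rw [hfm, mul_nsmul, hy₀, nsmul_zero]
  -- at `v₃`: `I_{v₃} ∩ ker κ ⊆ {σ ∈ D_{v₃} | σθ = θ}` fixes the good root
  have h3case : ∀ σ ∈ inertia v₃, σ ∈ κ.kerSubgroup → fτ σ = 0 := fun σ hσ hσker ↦
    hvanish σ hσker (hβτfix σ (inertia_le_decomp v₃ hσ) (hkerθ σ hσker))
  refine ⟨fτ, Fτ, hFτ, ?_, ?_, ?_⟩
  · -- `conj_τ [F] = [F₁] = [Fτ]`
    have e1 : conjH1 κ.kerSubgroup Ψ τ (oneCocycleClass (discreteTopRep κ.kerSubgroup Ψ) F) =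
        oneCocycleClass (discreteTopRep κ.kerSubgroup Ψ) F₁ :=
      conjH1_eq_of_kummer (p := 3) κ.kerSubgroup hΨ hy₀ hζ₃ hβ0 τ F F₁ hF
        (fun h ↦ by obtain ⟨m, hm, hfm⟩ := hf₁rel h h.2; exact ⟨m, hm, by rw [hF₁]; exact hfm⟩)
    have e2 : oneCocycleClass (discreteTopRep κ.kerSubgroup Ψ) Fτ =
        oneCocycleClass (discreteTopRep κ.kerSubgroup Ψ) F₁ :=
      class_eq_of_root_mul_pow (p := 3) κ.kerSubgroup hΨ hy₀ hζ₃ hτβ0 j F₁ Fτ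
        (fun h ↦ by obtain ⟨m, hm, hfm⟩ := hf₁rel h h.2; exact ⟨m, hm, by rw [hF₁]; exact hfm⟩)
        (fun h ↦ by
          obtain ⟨m, hm, hfm⟩ := hfτrel h h.2
          exact ⟨m, by rw [← hj]; exact hm, by rw [hFτ]; exact hfm⟩)
    rw [e1, e2]
  · -- `v ∉ Σ₀`: either `v = v₃`, or `I_v ≤ ker κ` fixes `θ` (hence `τ a`) and `τa · b = n ∉ v`
    intro v hvS σ hσ hσker
    by_cases hv3 : ((3 : ℕ) : 𝓞 ℚ) ∈ v.asIdeal
    · rw [huniq3 v hv3] at hσ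
      exact h3case σ hσ hσker
    · refine hvanish σ hσker ?_
      have hint : IsIntegral (𝓞 ℚ) (τ • a) := by rw [hτa]; exact isIntegral_eval_theta hθ _ _ _
      have hprod : (τ • a) * b = (n : AlgebraicClosure ℚ) := by rw [hτa]; exact hQb
      exact smul_eq_self_of_mem_inertia_of_pow_eq_of_dvd (p := 3) hζ₃ hint hbint hprod hβτ' hv3
        (fun hnv ↦ hvS (hnS v hnv)) hσ (hkera σ hσker)
  · -- `v ∣ 3`
    intro v hv3 σ hσ hσker
    rw [huniq3 v hv3] at hσ
    exact h3case σ hσ hσker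

end KummerLayerClasses

end Summit.BirchSwinnertonDyer.Rank1Residual.Additive

end
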